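import Summits.KontsevichZagierPeriods.KontsevichZagierPeriods.Theses.FurushoPentagon
import Summits.KontsevichZagierPeriods.KontsevichZagierPeriods.Theorems.ReducedPeriodRing.Negative.ModelsAnatomy

/-!
# `ReducedPeriodRing` (stmt-KontsevichZagierPeriods-3929), line `effective-end-monoid`: proof skeleton

Lead prover's skeleton (reconstructed from the stub registry of the planner's checked skeleton
`line-effective-end-monoid.lean`, whose tree mirror was never written). The crux
`FurushoPentagon.ReducedPeriodRing` (`c * c ∈ KZ.relations → c ∈ KZ.relations`) is derived from
seven registered stubs about the CUBICAL EFFECTIVE SUB-CALCULUS (definitions: the block marked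
`-- BEGIN DEFS … -- END DEFS` below, to be landed verbatim as
`Theorems/FurushoPentagonReducedPeriodRingDefs.lean`):

* S1a `stub_cubeMerge` — a `ℤ`-combination of tame cube classes is ONE tame cube class modulo
  `KZ.relations` (dimension padding by Newton–Leibniz with `F = t·f`, sums by integrand additivity,
  signs by `[σ,−f] ∼ −[σ,f]`); M.
* S1b `stub_cubeResolution` — every representation is a `ℤ`-combination of tame cube classes
  modulo `KZ.relations` (Viu-Sos semi-canonical reduction + cell decomposition + resolution of the
  boundary singularities of Nash integrands); XL.
* S2a `stub_cubeAddCov_sound`, S2b `stub_cubeNewtonLeibniz_sound`, S2c `stub_cubeHalving_sound` —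
  the four cubical move families are KZ relations; S/M.
* S3 `stub_cubicalCoherence` — a tame cube class which is a KZ relation is a CUBICAL relation
  (conservativity of the full calculus over the cubical one on cube classes); XL.
* S4 `stub_cubicalSqrtClosed` — the cubical effective algebra has no square roots of zero on
  generators: `[r ⊠ r] ∈ cubeRelations → [r] ∈ cubeRelations`; XL, hardest (the lead's).

Composition (`ReducedPeriodRing_of`): `c ∼ [u]` one signed representation
(`ReducedPeriodRingNegative.exists_sub_of_mem_relations`), `[u] ∼ [r]` a tame cube class (S1b+S1a),
`[r]·[r] ∼ c·c ∈ relations` (two-sided ideal), `[r ⊠ r]` is a tame cube class (`prod_cubical`),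
hence a cubical relation (S3), hence `[r] ∈ cubeRelations` (S4) `⊆ relations` (S2), hence
`c ∈ relations`.
-/

noncomputable section

namespace Summit.KontsevichZagierPeriods.FurushoPentagon.ReducedPeriodRing
-- BEGIN DEFS (verbatim body of Theorems/FurushoPentagonReducedPeriodRingDefs.lean)


open Set
open Literature.NumberTheory.Transcendental Literature.NumberTheory.Transcendental.KZ

/-- The closed unit cube `[0,1]ⁿ = {x : ℝⁿ | ∀ i, 0 ≤ x i ≤ 1}`.
[Kontsevich–Zagier 2001, §1.1; Ayoub 2014, Def. 6] -/
def unitCube (n : ℕ) : Set (Fin n → ℝ) := {x | ∀ i, 0 ≤ x i ∧ x i ≤ 1}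

/-- Membership in the unit cube. [folklore] -/
@[simp] theorem mem_unitCube {n : ℕ} (x : Fin n → ℝ) : x ∈ unitCube n ↔ ∀ i, 0 ≤ x i ∧ x i ≤ 1 :=
  Iff.rfl

/-- The *tame cube classes*: generators `[r]` of `KZ.FormalRep` whose domain is the closed unit
cube and whose integrand is real analytic on a neighbourhood of each point of the cube.
[Ayoub 2014, Def. 6 (generators of `P^eff_KZ`); Huber–Müller-Stach 2017, §12.1] -/
def cubicalGens : Set FormalRep :=
  {d | ∃ (n : ℕ) (r : IntegralRep n),
    r.domain = unitCube n ∧ AnalyticOnNhd ℝ r.integrand (unitCube n) ∧ d = of r}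

/-- The subgroup of `KZ.FormalRep` generated by the tame cube classes (`ℤ[tame cube classes]`).
[Ayoub 2014, Def. 6] -/
def cubicalSpan : AddSubgroup FormalRep := AddSubgroup.closure cubicalGens

/-- **Cubical move (1b)**: integrand additivity `f = f₁ + f₂` between tame cube classes of the same
dimension. [Kontsevich–Zagier 2001, §1.2 rule (1)] -/
def cubeIntegrandAddRel : Set FormalRep :=
  {c | ∃ (n : ℕ) (r r₁ r₂ : IntegralRep n),
    r.domain = unitCube n ∧ AnalyticOnNhd ℝ r.integrand (unitCube n) ∧
    r₁.domain = unitCube n ∧ AnalyticOnNhd ℝ r₁.integrand (unitCube n) ∧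
    r₂.domain = unitCube n ∧ AnalyticOnNhd ℝ r₂.integrand (unitCube n) ∧
    EqOn r.integrand (r₁.integrand + r₂.integrand) (unitCube n) ∧
    c = of r - of r₁ - of r₂}

/-- **Cubical move (3)**: Newton–Leibniz along the last coordinate of the cube `[0,1]ⁿ⁺¹ → [0,1]ⁿ`,
`∫_{[0,1]ⁿ⁺¹} ∂ₜF = ∫_{[0,1]ⁿ} (F(x,1) − F(x,0))`, for a primitive `F` which is analytic on a
neighbourhood of the cube, `ℚ`-semialgebraic on it, and has `∂ₜ F = f` on every closed fibre.
[Kontsevich–Zagier 2001, §1.2 rule (3); Ayoub 2014, Def. 6 (Stokes generators)] -/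
def cubeNewtonLeibnizRel : Set FormalRep :=
  {c | ∃ (n : ℕ) (r : IntegralRep (n + 1)) (r' : IntegralRep n) (F : (Fin (n + 1) → ℝ) → ℝ),
    r.domain = unitCube (n + 1) ∧ AnalyticOnNhd ℝ r.integrand (unitCube (n + 1)) ∧
    r'.domain = unitCube n ∧ AnalyticOnNhd ℝ r'.integrand (unitCube n) ∧
    AnalyticOnNhd ℝ F (unitCube (n + 1)) ∧ IsSemialgebraicFunOn ℚ (unitCube (n + 1)) F ∧
    (∀ x ∈ unitCube n, ∀ t ∈ Icc (0 : ℝ) 1,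
      HasDerivAt (fun s : ℝ => F (Fin.snoc x s)) (r.integrand (Fin.snoc x t)) t) ∧
    (∀ x ∈ unitCube n, r'.integrand x = F (Fin.snoc x 1) - F (Fin.snoc x 0)) ∧
    c = of r - of r'}

/-- **Cubical move (2)**: change of variables along a `ℚ`-semialgebraic analytic diffeomorphism
`Φ` of the cube onto itself, `∫_{[0,1]ⁿ} f'(Φ x) |det Φ'(x)| = ∫_{[0,1]ⁿ} f'`.
[Kontsevich–Zagier 2001, §1.2 rule (2)] -/
def cubeChangeOfVariablesRel : Set FormalRep :=
  {c | ∃ (n : ℕ) (r r' : IntegralRep n) (Φ : (Fin n → ℝ) → (Fin n → ℝ))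
      (Φ' : (Fin n → ℝ) → ((Fin n → ℝ) →L[ℝ] (Fin n → ℝ))),
    r.domain = unitCube n ∧ AnalyticOnNhd ℝ r.integrand (unitCube n) ∧
    r'.domain = unitCube n ∧ AnalyticOnNhd ℝ r'.integrand (unitCube n) ∧
    IsSemialgebraicMapOn ℚ (unitCube n) Φ ∧
    (∀ x ∈ unitCube n, HasFDerivWithinAt Φ (Φ' x) (unitCube n) x) ∧
    InjOn Φ (unitCube n) ∧ Φ '' unitCube n = unitCube n ∧
    (∀ i : Fin n, AnalyticOnNhd ℝ (fun x : Fin n → ℝ => Φ x i) (unitCube n)) ∧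
    (∀ x ∈ unitCube n, r.integrand x = r'.integrand (Φ x) * |(Φ' x).det|) ∧
    c = of r - of r'}

/-- **Cubical move (1a)**: dyadic halving of the `i`-th coordinate,
`∫_{[0,1]ⁿ} f = ∫_{[0,1]ⁿ} ½ f(…, xᵢ/2, …) + ∫_{[0,1]ⁿ} ½ f(…, (1+xᵢ)/2, …)` (domain additivity
along the null wall `xᵢ = ½` followed by the two affine rescalings of the halves to the cube).
[Kontsevich–Zagier 2001, §1.2 rules (1), (2)] -/
def cubeHalvingRel : Set FormalRep :=
  {c | ∃ (n : ℕ) (r r₁ r₂ : IntegralRep n) (i : Fin n),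
    r.domain = unitCube n ∧ AnalyticOnNhd ℝ r.integrand (unitCube n) ∧
    r₁.domain = unitCube n ∧ AnalyticOnNhd ℝ r₁.integrand (unitCube n) ∧
    r₂.domain = unitCube n ∧ AnalyticOnNhd ℝ r₂.integrand (unitCube n) ∧
    (∀ x ∈ unitCube n, r₁.integrand x = (1 / 2 : ℝ) * r.integrand (Function.update x i (x i / 2))) ∧
    (∀ x ∈ unitCube n,
      r₂.integrand x = (1 / 2 : ℝ) * r.integrand (Function.update x i ((1 + x i) / 2))) ∧
    c = of r - of r₁ - of r₂}

/-- The four cubical move families together. [Kontsevich–Zagier 2001, §1.2] -/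
def cubeMoves : Set FormalRep :=
  cubeIntegrandAddRel ∪ cubeNewtonLeibnizRel ∪ cubeChangeOfVariablesRel ∪ cubeHalvingRel

/-- The subgroup of `KZ.FormalRep` generated by the cubical moves: the relations of the cubical
effective sub-calculus (`A_□ = cubicalSpan ⧸ cubeRelations`). [Kontsevich–Zagier 2001, §1.2] -/
def cubeRelations : AddSubgroup FormalRep := AddSubgroup.closure cubeMoves

/-- Each cubical move family lies in `cubeMoves`. [folklore] -/
theorem cubeIntegrandAddRel_subset_cubeMoves : cubeIntegrandAddRel ⊆ cubeMoves := fun _ hc =>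
  Or.inl (Or.inl (Or.inl hc))

/-- Each cubical move family lies in `cubeMoves`. [folklore] -/
theorem cubeNewtonLeibnizRel_subset_cubeMoves : cubeNewtonLeibnizRel ⊆ cubeMoves := fun _ hc =>
  Or.inl (Or.inl (Or.inr hc))

/-- Each cubical move family lies in `cubeMoves`. [folklore] -/
theorem cubeChangeOfVariablesRel_subset_cubeMoves : cubeChangeOfVariablesRel ⊆ cubeMoves :=
  fun _ hc => Or.inl (Or.inr hc)

/-- Each cubical move family lies in `cubeMoves`. [folklore] -/
theorem cubeHalvingRel_subset_cubeMoves : cubeHalvingRel ⊆ cubeMoves := fun _ hc => Or.inr hc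

-- END DEFS

open Set
open Literature.NumberTheory.Transcendental Literature.NumberTheory.Transcendental.KZ
open Summit.KontsevichZagierPeriods.KontsevichZagierPeriods.Theses.FurushoPentagon

/-! ## Registered stubs -/

/-- **S1a (merging).** A `ℤ`-combination of tame cube classes is a single tame cube class modulo
the KZ relations. [Kontsevich–Zagier 2001, §1.2] -/
theorem stub_cubeMerge : ∀ c : FormalRep, c ∈ cubicalSpan →
    ∃ (n : ℕ) (r : IntegralRep n), r.domain = unitCube n ∧
      AnalyticOnNhd ℝ r.integrand (unitCube n) ∧ c - of r ∈ relations := by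
  sorry

/-- **S1b (resolution / compilation).** Every integral representation is, modulo the KZ relations,
a `ℤ`-combination of tame cube classes. [Ayoub 2014, Rem. 12; Viu-Sos 2021, Thm. 1.1] -/
theorem stub_cubeResolution : ∀ (N : ℕ) (u : IntegralRep N),
    ∃ c : FormalRep, c ∈ cubicalSpan ∧ of u - c ∈ relations := by
  sorry

/-- **S2a (soundness of cubical integrand additivity and change of variables).** Both families are
instances of the corresponding KZ moves. [Kontsevich–Zagier 2001, §1.2 rules (1), (2)] -/
theorem stub_cubeAddCov_sound :
    cubeIntegrandAddRel ∪ cubeChangeOfVariablesRel ⊆ (relations : Set FormalRep) := by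
  sorry

/-- **S2b (soundness of cubical Newton–Leibniz).** The cube `[0,1]ⁿ⁺¹` is the band `a = 0 ≤ b = 1`
over `[0,1]ⁿ`. [Kontsevich–Zagier 2001, §1.2 rule (3)] -/
theorem stub_cubeNewtonLeibniz_sound : cubeNewtonLeibnizRel ⊆ (relations : Set FormalRep) := by
  sorry

/-- **S2c (soundness of dyadic halving).** Domain additivity along the null wall `xᵢ = ½` and two
affine changes of variables. [Kontsevich–Zagier 2001, §1.2 rules (1), (2)] -/
theorem stub_cubeHalving_sound : cubeHalvingRel ⊆ (relations : Set FormalRep) := by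
  sorry

/-- **S3 (coherence).** A tame cube class which is a KZ relation is a cubical relation.
[Ayoub 2014, Prop. 11 (presentation comparison), rules-side analogue] -/
theorem stub_cubicalCoherence : ∀ (n : ℕ) (r : IntegralRep n), r.domain = unitCube n →
    AnalyticOnNhd ℝ r.integrand (unitCube n) → of r ∈ relations → of r ∈ cubeRelations := by
  sorry

/-- **S4 (square-root closure of the cubical relations; hardest).** If the Fubini square of a tame
cube class is a cubical relation then so is the class. [effective-end-monoid: `A_□` reduced] -/
theorem stub_cubicalSqrtClosed : ∀ (n : ℕ) (r : IntegralRep n), r.domain = unitCube n →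
    AnalyticOnNhd ℝ r.integrand (unitCube n) → of (r.prod r) ∈ cubeRelations →
    of r ∈ cubeRelations := by
  sorry

/-! ## Glue (proved) -/

/-- The cubical relations are KZ relations (S2a–c). [Kontsevich–Zagier 2001, §1.2] -/
theorem cubeRelations_le_relations : cubeRelations ≤ relations := by
  refine (AddSubgroup.closure_le _).mpr ?_
  rintro c (((hc | hc) | hc) | hc)
  · exact stub_cubeAddCov_sound (Or.inl hc)
  · exact stub_cubeNewtonLeibniz_sound hc
  · exact stub_cubeAddCov_sound (Or.inr hc)
  · exact stub_cubeHalving_sound hc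

/-- **Cube compilation** (S1b then S1a): every representation is ONE tame cube class modulo the KZ
relations. [Ayoub 2014, Rem. 12] -/
theorem cubeCompilation {N : ℕ} (u : IntegralRep N) :
    ∃ (n : ℕ) (r : IntegralRep n), r.domain = unitCube n ∧
      AnalyticOnNhd ℝ r.integrand (unitCube n) ∧ of u - of r ∈ relations := by
  obtain ⟨c, hc, huc⟩ := stub_cubeResolution N u
  obtain ⟨n, r, hd, ha, hcr⟩ := stub_cubeMerge c hc
  refine ⟨n, r, hd, ha, ?_⟩
  have := relations.add_mem huc hcr
  simpa using this

/-- The product domain of two cubes is the cube. [folklore] -/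
theorem prodDomain_eq_unitCube {n m : ℕ} (r : IntegralRep n) (s : IntegralRep m)
    (hr : r.domain = unitCube n) (hs : s.domain = unitCube m) :
    IntegralRep.prodDomain r s = unitCube (n + m) := by
  ext z
  simp only [IntegralRep.mem_prodDomain, hr, hs, mem_unitCube]
  constructor
  · rintro ⟨h1, h2⟩ i
    induction i using Fin.addCases with
    | left i => simpa using h1 i
    | right j => simpa using h2 j
  · intro h
    exact ⟨fun i => h _, fun j => h _⟩

/-- Restriction to the first `n` coordinates maps the cube to the cube. [folklore] -/
theorem castAdd_mem_unitCube {n m : ℕ} {z : Fin (n + m) → ℝ} (hz : z ∈ unitCube (n + m)) :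
    (fun i => z (Fin.castAdd m i)) ∈ unitCube n := fun _ => hz _

/-- Restriction to the last `m` coordinates maps the cube to the cube. [folklore] -/
theorem natAdd_mem_unitCube {n m : ℕ} {z : Fin (n + m) → ℝ} (hz : z ∈ unitCube (n + m)) :
    (fun j => z (Fin.natAdd n j)) ∈ unitCube m := fun _ => hz _

/-- `f ⊗ g` is analytic on a neighbourhood of the cube when `f`, `g` are. [folklore] -/
theorem analyticOnNhd_prodFun {n m : ℕ} (r : IntegralRep n) (s : IntegralRep m)
    (hr : AnalyticOnNhd ℝ r.integrand (unitCube n)) (hs : AnalyticOnNhd ℝ s.integrand (unitCube m)) :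
    AnalyticOnNhd ℝ (IntegralRep.prodFun r s) (unitCube (n + m)) := by
  -- the two coordinate restrictions are continuous linear, hence analytic everywhere
  let p₁ : (Fin (n + m) → ℝ) →L[ℝ] (Fin n → ℝ) :=
    ContinuousLinearMap.pi fun i => ContinuousLinearMap.proj (Fin.castAdd m i)
  let p₂ : (Fin (n + m) → ℝ) →L[ℝ] (Fin m → ℝ) :=
    ContinuousLinearMap.pi fun j => ContinuousLinearMap.proj (Fin.natAdd n j)
  have h₁ : AnalyticOnNhd ℝ (fun z => r.integrand (p₁ z)) (unitCube (n + m)) :=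
    hr.comp (p₁.analyticOnNhd _) fun z hz => castAdd_mem_unitCube hz
  have h₂ : AnalyticOnNhd ℝ (fun z => s.integrand (p₂ z)) (unitCube (n + m)) :=
    hs.comp (p₂.analyticOnNhd _) fun z hz => natAdd_mem_unitCube hz
  have hfun : IntegralRep.prodFun r s = fun z => r.integrand (p₁ z) * s.integrand (p₂ z) := by
    funext z
    simp [IntegralRep.prodFun, p₁, p₂]
  rw [hfun]
  exact h₁.mul h₂

/-- **The Fubini product of two tame cube classes is a tame cube class.** [Kontsevich–Zagier 2001, §4.1] -/
theorem prod_cubical {n m : ℕ} (r : IntegralRep n) (s : IntegralRep m)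
    (hrd : r.domain = unitCube n) (hra : AnalyticOnNhd ℝ r.integrand (unitCube n))
    (hsd : s.domain = unitCube m) (hsa : AnalyticOnNhd ℝ s.integrand (unitCube m)) :
    (r.prod s).domain = unitCube (n + m) ∧
      AnalyticOnNhd ℝ (r.prod s).integrand (unitCube (n + m)) := by
  refine ⟨?_, ?_⟩
  · rw [IntegralRep.prod_domain, prodDomain_eq_unitCube r s hrd hsd]
  · rw [IntegralRep.prod_integrand_eq]
    exact analyticOnNhd_prodFun r s hra hsa

/-! ## The crux -/

/-- **`ReducedPeriodRing`** from the seven stubs of line `effective-end-monoid`: the formal period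
ring `KZ.FormalRep ⧸ KZ.relations` has no nilpotents. [Kontsevich–Zagier 2001, §1.2] -/
theorem ReducedPeriodRing_of : ReducedPeriodRing := by
  intro c hcc
  -- one signed representation `u` with `c ∼ [u]`
  obtain ⟨N, u, hcu⟩ :=
    Summit.KontsevichZagierPeriods.KontsevichZagierPeriods.ReducedPeriodRingNegative.exists_sub_of_mem_relations c
  -- compile it to a tame cube class `r`
  obtain ⟨n, r, hrd, hra, hur⟩ := cubeCompilation u
  have hcr : c - of r ∈ relations := by
    have := relations.add_mem hcu hur
    simpa using this
  have hrc : of r - c ∈ relations := by simpa using relations.neg_mem hcr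
  -- `[r ⊠ r] = [r]·[r] ∼ c·c ∈ relations`
  have hsq : of (r.prod r) ∈ relations := by
    have h1 : of r * of r - c * c ∈ relations := mul_sub_mul_mem_relations hrc hrc
    have := relations.add_mem h1 hcc
    rw [of_mul_of] at this
    simpa using this
  -- `r ⊠ r` is a tame cube class, so its class is a CUBICAL relation (S3)
  obtain ⟨hpd, hpa⟩ := prod_cubical r r hrd hra hrd hra
  have hsq' : of (r.prod r) ∈ cubeRelations := stub_cubicalCoherence (n + n) (r.prod r) hpd hpa hsq
  -- square-root closure (S4) and soundness (S2)
  have hr : of r ∈ relations := cubeRelations_le_relations (stub_cubicalSqrtClosed n r hrd hra hsq')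
  have := relations.add_mem hcr hr
  simpa using this

end Summit.KontsevichZagierPeriods.FurushoPentagon.ReducedPeriodRing
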